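import Literature.NumberTheory.EllipticCurves.HeegnerPoints
import HarnessLib

/-!
# Under the Heegner hypothesis for `p`, every place `v ∋ p` has a conjugate place `v̄ ≠ v` above `p` (theorems only)

`Proofs` file (THEOREMS ONLY: no definition, no named fact, no instance, no `sorry`) in topic `NumberTheory/EllipticCurves`
(cell `pub/bsd-print-x9`, road CG-FRAME; `--supports` stmt-BirchSwinnertonDyer-23237).  `SatisfiesHeegnerHypothesis p K`
(`HeegnerPoints`: every prime `ℓ ∣ p`, i.e. `ℓ = p`, has exactly two primes of `𝓞 K` above it) ⟹ for every place `v`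
(in particular every `v ∋ p`) there is a place `v̄ ∋ p` with `v̄ ≠ v` — the binder shape `(hpvbar) (hne : vbar ≠ v)` of the anticyclotomic local bricks
(`inertia_inf_kerSubgroup_le_kerSubgroup_of_isAnticyclotomic`, `AnticyclotomicLocalInertiaProofs`,
`AnticyclotomicPConverseLinks`), produced from the frame hypothesis of `Stmt.kummerStrictOnFrames`.
No summit statement is proved; BSD is not proved by any of this.

References: [Gross1991] B. Gross, *Kolyvagin's work on modular elliptic curves*, §1 (the Heegner hypothesis: every prime
dividing the level splits in `K`); [CasselsFrohlich1967] Ch. I §10.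
-/

set_option autoImplicit false

noncomputable section

open NumberField IsDedekindDomain

namespace Literature.NumberTheory.EllipticCurves

variable {K : Type} [Field K] [NumberField K]

/-- A prime of `𝓞 K` over `(p)` contains `p` and is non-zero (private plumbing). [folklore] -/
private theorem natCast_mem_and_ne_bot_of_mem_primesOver_span_natCast {p : ℕ} (hp : p.Prime) {Q : Ideal (𝓞 K)}
    (hQ : Q ∈ (Ideal.span {(p : ℤ)}).primesOver (𝓞 K)) : ((p : ℕ) : 𝓞 K) ∈ Q ∧ Q ≠ ⊥ := by
  have h : ((p : ℕ) : ℤ) ∈ Q.under ℤ := hQ.2.over ▸ Ideal.mem_span_singleton_self _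
  rw [Ideal.under_def, Ideal.mem_comap, map_natCast] at h
  refine ⟨h, fun hQbot ↦ ?_⟩
  rw [hQbot, Ideal.mem_bot, Nat.cast_eq_zero] at h
  exact hp.ne_zero h

/-- **The conjugate place above a Heegner prime.**  If `p` satisfies the Heegner hypothesis in `K` (`(p)` has exactly two
primes in `𝓞 K`), then every place `v` (in particular every `v ∋ p`) has a companion place `v̄ ∋ p` with `v̄ ≠ v`.
[cite: Gross1991, §1 (Heegner hypothesis: p splits, (p) = 𝔭 𝔭̄ with 𝔭 ≠ 𝔭̄)] -/
theorem exists_ne_natCast_mem_of_satisfiesHeegnerHypothesis {p : ℕ} (hp : p.Prime)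
    (hHeeg : SatisfiesHeegnerHypothesis p K) (v : HeightOneSpectrum (𝓞 K)) :
    ∃ vbar : HeightOneSpectrum (𝓞 K), ((p : ℕ) : 𝓞 K) ∈ vbar.asIdeal ∧ vbar ≠ v := by
  obtain ⟨P, P', hne, hPP'⟩ := Set.ncard_eq_two.mp (hHeeg p hp dvd_rfl)
  have hP : P ∈ (Ideal.span {(p : ℤ)}).primesOver (𝓞 K) := hPP' ▸ Set.mem_insert P {P'}
  have hP' : P' ∈ (Ideal.span {(p : ℤ)}).primesOver (𝓞 K) := hPP' ▸ Set.mem_insert_of_mem P (Set.mem_singleton P')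
  obtain ⟨hpP, hPbot⟩ := natCast_mem_and_ne_bot_of_mem_primesOver_span_natCast hp hP
  obtain ⟨hpP', hP'bot⟩ := natCast_mem_and_ne_bot_of_mem_primesOver_span_natCast hp hP'
  by_cases hv : v.asIdeal = P
  · refine ⟨⟨P', hP'.1, hP'bot⟩, hpP', fun h ↦ hne ?_⟩
    rw [← hv, ← h]
  · refine ⟨⟨P, hP.1, hPbot⟩, hpP, fun h ↦ hv ?_⟩
    rw [← h]

/-- The same with `[Fact p.Prime]` (consumer shape `(hpvbar : (p : 𝓞 K) ∈ vbar.asIdeal) (hne : vbar ≠ v)` of the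
anticyclotomic local bricks). [cite: Gross1991, §1] -/
theorem exists_conjugatePlace_of_satisfiesHeegnerHypothesis {p : ℕ} [hp : Fact p.Prime]
    (hHeeg : SatisfiesHeegnerHypothesis p K) (v : HeightOneSpectrum (𝓞 K)) :
    ∃ vbar : HeightOneSpectrum (𝓞 K), ((p : ℕ) : 𝓞 K) ∈ vbar.asIdeal ∧ vbar ≠ v :=
  exists_ne_natCast_mem_of_satisfiesHeegnerHypothesis hp.out hHeeg v

end Literature.NumberTheory.EllipticCurves

end
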